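import Literature.NumberTheory.GelbartRogawski1991.LocalDoubledSiegelUnipotentMover
import HarnessLib

-- buildfix G11b-3 recipe (LEDGER B13-1/B13-3), as in the GelbartRogawski1991 siblings: elaborate sequentially.
set_option Elab.async false

/-!
# The Rao parameter of a SCALAR Siegel unipotent of the doubled unitary group is ANISOTROPIC when the hermitian space is
# (the `hc` input of the «no invariant functional» argument, [MoeglinVignerasWaldspurger1987, Chap. 3 §IV])

Topic `NumberTheory/GelbartRogawski1991`; namespace `Literature.NumberTheory.GelbartRogawski1991.UnitaryDualPair.LocalSplitting` (sequel of ★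
`LocalDoubledSiegelUnipotentMover`). KERNEL ONLY: theorems; no definition, no named fact, no `sorry`.

Setting of ★ `LocalDoubledSiegelUnipotentMover`: `E/F`, `(c, δ, d)`, a finite place `v`, `T₀ ∈ M_n(F)` symmetric non-degenerate with
`𝕋₀ := gramS F E v n T₀ = T₀ ⊗ 1 ∈ M_n(E ⊗ F_v)`, the doubled group `H(F_v)`, `ι = iotaD`, the frame `eD`, `ℓ_Δ`, `ℓ_Y`, a MOVER `E′` (`E′ ℓ_Δ = ℓ_Y`,
ANY such), and an adapted unipotent `g` whose parameter is a SKEW SCALAR: `adapt (matA g) = [[1, τ·1], [0, 1]]`, `c̄(τ) = −τ`, `τ ≠ 0` — e.g. the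
Kronecker image `kronLoc (nElem₁ (τ))` of a rank-one Siegel unipotent (★ `kronLoc_nElem`), i.e. `nElem (τ • 1)` (`skew_smul_one`). Its Rao
parameter is `c := cOfFix 𝕋 (E′ ι(g) E′⁻¹) ∈ M_{n+n}(F_v)` (★ `mover_conj_iotaD_eq_transportSp_low`).

* §1 quadratic-coordinate plumbing in `E ⊗ F_v = F_v ⊕ F_v δ` (★ `IsQuadraticCoordinates`, `isQuadraticCoordinates_local`): a `c̄`-FIXED element
  has `im = 0`, a `c̄`-SKEW one has `re = 0`; `im (2 τ H) = 2 · im τ · re H` for `τ` skew and `H` fixed; `h_{𝕋₀}(b, b)` is `c̄`-fixed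
  (`conjLocal_hermForm_gramS_self`).
* §2 **the quadratic form of the Rao parameter** (`dotProduct_cOfFix_mover_conj_eq_im`): `⟨x, c x⟩ = im (2 · τ · h_{𝕋₀}(b, b))` with
  `b = halfDiff (eD⁻¹ (E′⁻¹ (x, 0)))` the `Δ⁻`-component (★ `dotProduct_cOfFix_mover_conj`, ★ `matA_mulVec_of_adapt`, ★ `formD_dblV_adblV`).
* §3 **ANISOTROPY TRANSFER** (`dotProduct_cOfFix_mover_conj_eq_zero_iff`, `halfForm_cOfFix_mover_conj_eq_zero_iff`): if `h_{𝕋₀}` is anisotropic over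
  `E ⊗ F_v` — `hS : ∀ x, UnitaryGroup.hermForm (conjLocal E c v) (gramS F E v n T₀) x x = 0 → x = 0` (the currency of ★ `LocalDoubledAnisotropicFactorisation`) —
  then `⟨x, c x⟩ = 0 ↔ x = 0`, i.e. **`halfForm (c ·) x = 0 ↔ x = 0`**: `im(2 τ h) = 0 ⇒ h(b,b) = 0 ⇒ b = 0 ⇒ E′⁻¹(x,0) ∈ ℓ_Δ ⇒ (x,0) ∈ ℓ_Y ⇒ x = 0`.
* §4 the named element `nElem (τ • 1) (skew_smul_one …)`.

USE (cell hodgecm-mathlib, half A line LD2, brick (GRP-N)∕(AN) «anisotropy transfer», LD2-plan (g3) DEALS #17 (3): `halfForm_cOfFix_eq_zero_iff (hS)`;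
consumer A-p19 (g31)'s (Z-van)): the hypothesis **`hc : ∀ x, halfForm (Matrix.mulVecLin c₁) x = 0 → x = 0`** of ★ S1∕S2
`functional_eq_zero_of_forall_unipOpPi_eq_of_fourierOpPi`, with `c₁ = cOfFix 𝕋 (E′ ι(nElem (τ • 1)) E′⁻¹)`, from the anisotropy `hS` of the letter's plane
(A-p13 (g40)'s (AN-core) supplies `hS`).  HONEST LABEL: symplectic linear algebra over `E ⊗ F_v`; nothing of [Liu2021] asserted; HC_CM is proved only modulo the
7 printed citations (2 remaining: hLiu418 = stmt-HodgeConjecture-24832, h413 = stmt-HodgeConjecture-24833) until rung 0 closes; count-neutral.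

## References
* C. Mœglin, M.-F. Vignéras, J.-L. Waldspurger, LNM 1291 (1987), Chap. 2 II.2, Chap. 3 §IV [MoeglinVignerasWaldspurger1987].
* S. S. Kudla, Israel J. Math. 87 (1994) 361–401, §3 [Kudla1994].
* M. Harris, S. S. Kudla, W. J. Sweet, J. Amer. Math. Soc. 9 (1996), §1 (1.11) [HarrisKudlaSweet1996].
* R. Ranga Rao, Pacific J. Math. 157 (1993), Lemma 3.2 (3.8) p. 351 [Rangarao1993].
-/

set_option autoImplicit false

noncomputable section

open NumberField IsDedekindDomain MeasureTheory Matrix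
open Literature.RepresentationTheory.HeisenbergGroup Literature.RepresentationTheory.HeisenbergGroup.SymplecticMatrix
open Literature.NumberTheory.Automorphic Literature.NumberTheory.Automorphic.UnitaryGroup Literature.NumberTheory.Weil1964
open Literature.NumberTheory.Automorphic.UnitaryGroup.QuadraticCoordinates
open Literature.NumberTheory.GelbartRogawski1991.AdaptedBlocks
open Literature.NumberTheory.GaloisRepresentations.IsNonarchimedeanLocalField
open Literature.GroupTheory Literature.LinearAlgebra.QuadraticForm

namespace Literature.NumberTheory.GelbartRogawski1991.UnitaryDualPair.LocalSplitting

variable (F : Type) [Field F] [NumberField F] (E : Type) [Field E] [NumberField E] [Algebra F E]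
  [Algebra.IsQuadraticExtension F E] (c : E ≃ₐ[F] E)
  {δ : E} (hcδ : c δ = -δ) (hδ : δ ≠ 0) {d : F} (hd : δ * δ = algebraMap F E d)
  (v : HeightOneSpectrum (𝓞 F)) (n : ℕ) {T₀ : Matrix (Fin n) (Fin n) F} (hT₀ : T₀.IsSymm) (hT₀d : IsUnit T₀.det)
  {JD : Matrix (Fin (n + n)) (Fin (n + n)) E} (hJD : JD = (gramD F n T₀).map (algebraMap F E))

/-! ## §1 Quadratic coordinates: fixed and skew elements of `E ⊗ F_v`, and `h(b, b)` is fixed -/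

include hd in
/-- a `c̄`-FIXED element of `E ⊗ F_v` has vanishing `δ`-coordinate. [cite: HarrisKudlaSweet1996, §1 (1.11)] -/
theorem im_eq_zero_of_conjLocal_eq {z : LocalRing E v} (hz : conjLocal E c v z = z) :
    im (quadraticLocalEquiv E v c hcδ hδ).toLinearEquiv.toAddEquiv z = 0 := by
  have h := (isQuadraticCoordinates_local E v c hcδ hδ hd).im_conj (conjLocal_toLocalRing c v)
    (by rw [conjLocal_algebraMap, hcδ, map_neg]) z
  rw [hz] at h
  exact add_self_eq_zero.1 (by rw [eq_neg_iff_add_eq_zero.1 h])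

include hd in
/-- a `c̄`-SKEW element of `E ⊗ F_v` has vanishing `1`-coordinate. [cite: HarrisKudlaSweet1996, §1 (1.11)] -/
theorem re_eq_zero_of_conjLocal_eq_neg {z : LocalRing E v} (hz : conjLocal E c v z = -z) :
    re (quadraticLocalEquiv E v c hcδ hδ).toLinearEquiv.toAddEquiv z = 0 := by
  have h := (isQuadraticCoordinates_local E v c hcδ hδ hd).re_conj (conjLocal_toLocalRing c v)
    (by rw [conjLocal_algebraMap, hcδ, map_neg]) z
  rw [hz, map_neg] at h
  exact add_self_eq_zero.1 (by rw [eq_neg_iff_add_eq_zero.1 h.symm])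

include hd in
/-- a `c̄`-fixed element with vanishing `1`-coordinate is `0`; used as: `re H = 0 ⇒ H = 0` for fixed `H`. [cite: HarrisKudlaSweet1996, §1 (1.11)] -/
theorem eq_zero_of_conjLocal_eq_of_re_eq_zero {z : LocalRing E v} (hz : conjLocal E c v z = z)
    (hre : re (quadraticLocalEquiv E v c hcδ hδ).toLinearEquiv.toAddEquiv z = 0) : z = 0 := by
  rw [← (isQuadraticCoordinates_local E v c hcδ hδ hd).re_add_im z, hre, im_eq_zero_of_conjLocal_eq F E c hcδ hδ hd v hz,
    map_zero, zero_mul, add_zero]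

include hd in
/-- a NON-ZERO `c̄`-skew element has non-vanishing `δ`-coordinate. [cite: HarrisKudlaSweet1996, §1 (1.11)] -/
theorem im_ne_zero_of_conjLocal_eq_neg {z : LocalRing E v} (hz : conjLocal E c v z = -z) (hz0 : z ≠ 0) :
    im (quadraticLocalEquiv E v c hcδ hδ).toLinearEquiv.toAddEquiv z ≠ 0 := by
  intro him
  apply hz0
  rw [← (isQuadraticCoordinates_local E v c hcδ hδ hd).re_add_im z, him, re_eq_zero_of_conjLocal_eq_neg F E c hcδ hδ hd v hz,
    map_zero, zero_mul, add_zero]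

include hd in
/-- **`im (2 τ H) = 2 · im τ · re H`** for `τ` skew and `H` fixed (so `im(2τH) = 0`, `τ ≠ 0` force `re H = 0`, i.e. `H = 0`).
[cite: HarrisKudlaSweet1996, §1 (1.11)] -/
theorem im_two_mul_skew_mul_fixed {τ H : LocalRing E v} (hH : conjLocal E c v H = H) :
    im (quadraticLocalEquiv E v c hcδ hδ).toLinearEquiv.toAddEquiv (2 * (τ * H)) =
      2 * (im (quadraticLocalEquiv E v c hcδ hδ).toLinearEquiv.toAddEquiv τ *
        re (quadraticLocalEquiv E v c hcδ hδ).toLinearEquiv.toAddEquiv H) := by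
  have hq := isQuadraticCoordinates_local E v c hcδ hδ hd
  rw [show (2 : LocalRing E v) = toLocalRing E v 2 from (map_ofNat _ 2).symm, hq.im_map_mul, hq.im_mul,
    im_eq_zero_of_conjLocal_eq F E c hcδ hδ hd v hH, mul_zero, zero_add]

include hcδ hδ hd hT₀ in
/-- **`h_{𝕋₀}(b, b)` is `c̄`-FIXED** (`𝕋₀ = T₀ ⊗ 1` real symmetric: ★ `gramS_map_conj`, ★ `gramS_transpose`):
`c̄ (Σ c̄(b_i) 𝕋₀ᵢⱼ b_j) = Σ b_i 𝕋₀ᵢⱼ c̄(b_j) = h(b, b)`. [cite: HarrisKudlaSweet1996, §1 (1.9)] -/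
theorem conjLocal_hermForm_gramS_self (b : Fin n → LocalRing E v) :
    conjLocal E c v (UnitaryGroup.hermForm (conjLocal E c v) (gramS F E v n T₀) b b) =
      UnitaryGroup.hermForm (conjLocal E c v) (gramS F E v n T₀) b b := by
  have hσσ : ∀ z : LocalRing E v, conjLocal E c v (conjLocal E c v z) = z := conjLocal_conjLocal' F E c hcδ hδ hd v
  have hTc : ∀ i j, conjLocal E c v (gramS F E v n T₀ i j) = gramS F E v n T₀ i j := fun i j => by
    have h := congrFun (congrFun (gramS_map_conj F E c v n (T₀ := T₀)) i) j
    rwa [Matrix.map_apply] at h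
  have hTs : ∀ i j, gramS F E v n T₀ i j = gramS F E v n T₀ j i := fun i j => by
    have h := congrFun (congrFun (gramS_transpose F E v n hT₀) j) i
    rwa [Matrix.transpose_apply] at h
  simp only [UnitaryGroup.hermForm, dotProduct, Matrix.mulVec, Function.comp_apply, map_sum, _root_.map_mul, hσσ, hTc,
    Finset.mul_sum]
  rw [Finset.sum_comm]
  refine Finset.sum_congr rfl fun i _ => Finset.sum_congr rfl fun j _ => ?_
  rw [hTs i j]
  ring

/-! ## §2 The quadratic form of the Rao parameter of a scalar Siegel unipotent -/

include hT₀ hJD in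
/-- **`⟨x, c x⟩ = im (2 · τ · h_{𝕋₀}(b, b))`** for the Rao parameter `c = cOfFix 𝕋 (E′ ι(g) E′⁻¹)` of an adapted unipotent with scalar parameter `τ · 1`
and ANY mover `E′`, where `b = halfDiff (eD⁻¹ (E′⁻¹ (x,0)))` is the `Δ⁻`-component of the transported vector (★ `dotProduct_cOfFix_mover_conj` +
★ `matA_mulVec_of_adapt` + ★ `formD_dblV_adblV`). [cite: Kudla1994, §3; HarrisKudlaSweet1996, §1 (1.11); Rangarao1993, Lemma 3.2 (3.8), p. 351] -/
theorem dotProduct_cOfFix_mover_conj_eq_im (g : UnitaryGroup.localPi E c (n + n) JD v) (τ : LocalRing E v)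
    (hg : adapt (matA F E c v n g) = Matrix.fromBlocks 1 (τ • (1 : Matrix (Fin n) (Fin n) (LocalRing E v))) 0 1)
    (E' : LocalSp F (n + n) (gramD F n T₀) v) (x : Fin (n + n) → v.adicCompletion F) :
    x ⬝ᵥ cOfFix (localGram F (n + n) (gramD F n T₀) v) (E' * iotaD F E c hcδ hδ hd v n hT₀ hJD g * E'⁻¹) *ᵥ x =
      im (quadraticLocalEquiv E v c hcδ hδ).toLinearEquiv.toAddEquiv
        (2 * (τ * UnitaryGroup.hermForm (conjLocal E c v) (gramS F E v n T₀)
          (halfDiff ((eD F E c hcδ hδ hd v n).symm (toLin F v E'⁻¹ (x, 0))))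
          (halfDiff ((eD F E c hcδ hδ hd v n).symm (toLin F v E'⁻¹ (x, 0)))))) := by
  set u := (eD F E c hcδ hδ hd v n).symm (toLin F v E'⁻¹ (x, 0)) with hu
  have hsplit : dblV (halfSum u) + adblV (halfDiff u) = u := dblV_halfSum_add_adblV_halfDiff u
  rw [dotProduct_cOfFix_mover_conj F E c hcδ hδ hd v n hT₀ hJD g E' x, ← hu, matA_mulVec_of_adapt F E c v n g (τ • 1) hg u, map_add,
    isAlt_formD F E c hcδ hδ hd v n u, zero_add, Matrix.smul_mulVec, Matrix.one_mulVec]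
  have key : formD F E c hcδ hδ hd v n T₀ u (dblV (τ • halfDiff u)) =
      formD F E c hcδ hδ hd v n T₀ (dblV (halfSum u) + adblV (halfDiff u)) (dblV (τ • halfDiff u) + adblV 0) := by
    rw [hsplit, adblV_zero, add_zero]
  rw [key, formD_dblV_adblV F E c hcδ hδ hd v n hT₀ hJD, Matrix.mulVec_zero, dotProduct_zero, zero_add, Matrix.mulVec_smul,
    dotProduct_smul, smul_eq_mul]
  rfl

/-! ## §3 Anisotropy transfer -/

include hT₀ hJD in
/-- **ANISOTROPY TRANSFER**: if `h_{𝕋₀}` is anisotropic over `E ⊗ F_v` then the Rao parameter of a NON-ZERO skew-scalar Siegel unipotent is anisotropic: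
`⟨x, c x⟩ = 0 ↔ x = 0` (`c = cOfFix 𝕋 (E′ ι(g) E′⁻¹)`, any mover `E′`). Proof: `im(2 τ h(b,b)) = 2 im τ · re h(b,b)` with `im τ ≠ 0` gives `h(b,b) = 0`,
so `b = 0`, `eD⁻¹ E′⁻¹ (x,0) ∈ Δ`, `E′⁻¹(x,0) ∈ ℓ_Δ`, `(x,0) ∈ E′ ℓ_Δ = ℓ_Y = {x = 0}`. [cite: MoeglinVignerasWaldspurger1987, Chap. 3 §IV; Kudla1994, §3] -/
theorem dotProduct_cOfFix_mover_conj_eq_zero_iff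
    (hS : ∀ x : Fin n → LocalRing E v, UnitaryGroup.hermForm (conjLocal E c v) (gramS F E v n T₀) x x = 0 → x = 0)
    (g : UnitaryGroup.localPi E c (n + n) JD v) (τ : LocalRing E v) (hτ : conjLocal E c v τ = -τ) (hτ0 : τ ≠ 0)
    (hg : adapt (matA F E c v n g) = Matrix.fromBlocks 1 (τ • (1 : Matrix (Fin n) (Fin n) (LocalRing E v))) 0 1)
    (E' : LocalSp F (n + n) (gramD F n T₀) v) (hE' : (deltaLagrangian F v n).map (toLin F v E') = lagrangianY F (n + n) v)
    (x : Fin (n + n) → v.adicCompletion F) :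
    x ⬝ᵥ cOfFix (localGram F (n + n) (gramD F n T₀) v) (E' * iotaD F E c hcδ hδ hd v n hT₀ hJD g * E'⁻¹) *ᵥ x = 0 ↔ x = 0 := by
  haveI : CharZero (v.adicCompletion F) := charZero_of_injective_algebraMap (algebraMap F (v.adicCompletion F)).injective
  refine ⟨fun hx => ?_, fun hx => by rw [hx, zero_dotProduct]⟩
  set u := (eD F E c hcδ hδ hd v n).symm (toLin F v E'⁻¹ (x, 0)) with hu
  set H := UnitaryGroup.hermForm (conjLocal E c v) (gramS F E v n T₀) (halfDiff u) (halfDiff u) with hH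
  rw [dotProduct_cOfFix_mover_conj_eq_im F E c hcδ hδ hd v n hT₀ hJD g τ hg E' x, ← hu, ← hH,
    im_two_mul_skew_mul_fixed F E c hcδ hδ hd v (conjLocal_hermForm_gramS_self F E c hcδ hδ hd v n hT₀ (halfDiff u))] at hx
  -- `2 · im τ · re H = 0` with `im τ ≠ 0`
  have hre : re (quadraticLocalEquiv E v c hcδ hδ).toLinearEquiv.toAddEquiv H = 0 := by
    rcases mul_eq_zero.1 hx with h2 | h
    · exact absurd h2 two_ne_zero
    · exact (mul_eq_zero.1 h).resolve_left (im_ne_zero_of_conjLocal_eq_neg F E c hcδ hδ hd v hτ hτ0)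
  -- `H = 0`, hence `b = 0`
  have hb : halfDiff u = 0 :=
    hS _ (eq_zero_of_conjLocal_eq_of_re_eq_zero F E c hcδ hδ hd v (conjLocal_hermForm_gramS_self F E c hcδ hδ hd v n hT₀ (halfDiff u)) hre)
  -- `u ∈ Δ`, `E′⁻¹ (x,0) ∈ ℓ_Δ`, `(x,0) ∈ ℓ_Y`
  have hu' : u ∈ deltaV F E v n := by
    rw [mem_deltaV_iff_exists]
    exact ⟨halfSum u, by rw [← dblV_halfSum_add_adblV_halfDiff u, hb, adblV_zero, add_zero, halfSum_dblV]⟩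
  have hw : toLin F v E'⁻¹ (x, 0) ∈ deltaLagrangian F v n := by
    rw [← map_eD_deltaV F E c hcδ hδ hd v n]
    exact ⟨u, hu', by rw [hu, LinearEquiv.coe_coe, LinearEquiv.apply_symm_apply]⟩
  have hx0 : ((x, (0 : Fin (n + n) → v.adicCompletion F)) : (Fin (n + n) → v.adicCompletion F) × (Fin (n + n) → v.adicCompletion F)) ∈
      lagrangianY F (n + n) v := by
    rw [← hE']
    refine ⟨toLin F v E'⁻¹ (x, 0), hw, ?_⟩
    simp only [LinearEquiv.coe_coe, Subgroup.coe_inv, LinearEquiv.coe_inv, LinearEquiv.apply_symm_apply]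
  rw [lagrangianY, Submodule.mem_prod, Submodule.mem_bot] at hx0
  exact hx0.1

include hT₀ hJD in
/-- **`halfForm (c ·) x = 0 ↔ x = 0`** — the anisotropy hypothesis `hc` of ★ S1∕S2 `functional_eq_zero_of_forall_unipOpPi_eq_of_fourierOpPi` for the Rao
parameter `c = cOfFix 𝕋 (E′ ι(g) E′⁻¹)` of a non-zero skew-scalar Siegel unipotent, from the anisotropy of `h_{𝕋₀}` (`halfForm c x = ½⟨x, c x⟩`).
[cite: MoeglinVignerasWaldspurger1987, Chap. 3 §IV; Rangarao1993, Lemma 3.2 (3.8), p. 351] -/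
theorem halfForm_cOfFix_mover_conj_eq_zero_iff
    (hS : ∀ x : Fin n → LocalRing E v, UnitaryGroup.hermForm (conjLocal E c v) (gramS F E v n T₀) x x = 0 → x = 0)
    (g : UnitaryGroup.localPi E c (n + n) JD v) (τ : LocalRing E v) (hτ : conjLocal E c v τ = -τ) (hτ0 : τ ≠ 0)
    (hg : adapt (matA F E c v n g) = Matrix.fromBlocks 1 (τ • (1 : Matrix (Fin n) (Fin n) (LocalRing E v))) 0 1)
    (E' : LocalSp F (n + n) (gramD F n T₀) v) (hE' : (deltaLagrangian F v n).map (toLin F v E') = lagrangianY F (n + n) v)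
    (x : Fin (n + n) → v.adicCompletion F) :
    halfForm (Matrix.mulVecLin (cOfFix (localGram F (n + n) (gramD F n T₀) v) (E' * iotaD F E c hcδ hδ hd v n hT₀ hJD g * E'⁻¹))) x = 0 ↔
      x = 0 := by
  have h2 : (⅟(2 : v.adicCompletion F)) ≠ 0 := fun h =>
    absurd (invOf_mul_self' (2 : v.adicCompletion F)) (by rw [h, zero_mul]; exact zero_ne_one)
  rw [halfForm, dotProductBilin_apply_apply, Matrix.mulVecLin_apply, mul_eq_zero,
    dotProduct_cOfFix_mover_conj_eq_zero_iff F E c hcδ hδ hd v n hT₀ hJD hS g τ hτ hτ0 hg E' hE' x, or_iff_right h2]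

/-! ## §4 The named scalar Siegel unipotent `n(τ · 1)` -/

omit [Algebra.IsQuadraticExtension F E] in
/-- a skew scalar `τ · 1` (`c̄ τ = −τ`) is `𝕋₀`-skew: `(c̄(τ·1))ᵀ 𝕋₀ + 𝕋₀ (τ·1) = 0` — the hypothesis of ★ `nElem` for the parameter `τ • 1`.
[cite: Kudla1994, §3] -/
theorem skew_smul_one (τ : LocalRing E v) (hτ : conjLocal E c v τ = -τ) :
    ((τ • (1 : Matrix (Fin n) (Fin n) (LocalRing E v))).map (conjLocal E c v))ᵀ * gramS F E v n T₀ +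
      gramS F E v n T₀ * (τ • (1 : Matrix (Fin n) (Fin n) (LocalRing E v))) = 0 := by
  rw [Matrix.map_smul' _ _ _ (map_mul (conjLocal E c v)), Matrix.map_one _ (map_zero _) (map_one _), hτ, Matrix.transpose_smul,
    Matrix.transpose_one, Matrix.smul_mul, Matrix.mul_smul, Matrix.one_mul, Matrix.mul_one, neg_smul, neg_add_cancel]

include hcδ hδ hd hT₀ in
/-- **`halfForm (c ·) x = 0 ↔ x = 0`** for `c = cOfFix 𝕋 (E′ ι(n(τ·1)) E′⁻¹)`, the tree's Siegel unipotent ★ `nElem (τ • 1)` with `τ` skew non-zero (the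
Kronecker image of a rank-one Siegel unipotent, ★ `kronLoc_nElem`), ANY mover `E′`, given the anisotropy `hS` of `h_{𝕋₀}`.
[cite: MoeglinVignerasWaldspurger1987, Chap. 3 §IV; Kudla1994, §3] -/
theorem halfForm_cOfFix_mover_conj_nElem_eq_zero_iff
    (hS : ∀ x : Fin n → LocalRing E v, UnitaryGroup.hermForm (conjLocal E c v) (gramS F E v n T₀) x x = 0 → x = 0)
    (τ : LocalRing E v) (hτ : conjLocal E c v τ = -τ) (hτ0 : τ ≠ 0)
    (E' : LocalSp F (n + n) (gramD F n T₀) v) (hE' : (deltaLagrangian F v n).map (toLin F v E') = lagrangianY F (n + n) v)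
    (x : Fin (n + n) → v.adicCompletion F) :
    halfForm (Matrix.mulVecLin (cOfFix (localGram F (n + n) (gramD F n T₀) v)
      (E' * iotaD F E c hcδ hδ hd v n hT₀ hJD (nElem F E c v n hJD (τ • 1) (skew_smul_one F E c v n τ hτ)) * E'⁻¹))) x = 0 ↔ x = 0 :=
  halfForm_cOfFix_mover_conj_eq_zero_iff F E c hcδ hδ hd v n hT₀ hJD hS _ τ hτ hτ0 (adapt_matA_nElem F E c v n hJD _ _) E' hE' x

end Literature.NumberTheory.GelbartRogawski1991.UnitaryDualPair.LocalSplitting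

end
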